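import Summits.HodgeConjecture.HodgeConjecture.Theorems.LinearSystemTorelliLocalTubeSpanThm29
import Summits.HodgeConjecture.HodgeConjecture.Theorems.LinearSystemTorelliLocalTubeSpanSp2Closure
import Summits.HodgeConjecture.HodgeConjecture.Theorems.LinearSystemTorelliLocalTubeSpanLatticeCoordinates

/-!
# Route LinearSystemTorelli — crux `LocalTubeSpan` (stmt-HodgeConjecture-2490): the DESCENT — Janssen's Theorem 2.5 reduced to its residual

Composition file of line `Sketch`, cycle 8 (continuation lead c7).  Write `K = Sp♯₂(ℤΔ)` for the units
of `End V` satisfying the four hypotheses of the named fact `Janssen1983_thm2_5` (isometry of `B`,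
preserving `ℤΔ` both ways, Schnell's displayed condition `l(gx - x) = 2⟨v, x⟩`), `Γ = Γ_Δ`, and let
`u, w ∈ Δ` be a unimodular pair (`⟨u, w⟩ = 1`).

* lattice coordinates (`…LatticeCoordinates`): a vector on which every integral functional is even
  (zero) is twice a lattice vector (zero); the fourth condition makes `g y - y` even for `y ∈ ℤΔ`.
* `localTubeSpan_descent` — **every `g ∈ K` is `h · g'` with `h ∈ Γ ∩ K` and `g'` FIXING `u` AND `w`**:
  `g u` is unimodular and `≡ u (mod 2ℤΔ)`, hence reachable from `u` by the local moves (`…Thm29`: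
  `localTubeSpan_pairMoves`, squares of `T_u, T_w, T_{u+w}`) inside the subgroup `Γ ⊓ K` (cut out with
  `…Sp2Closure`); then `g w = w + 2z`, `z ⟂ u`, is corrected by `E_{u,-z}²` and `T_u^{2⟨w,z⟩}`.
* `localTubeSpan_residual_of_isotropic` — the residual when `B` vanishes on the orthogonal `N` of the pair
  inside `ℤΔ` (`ℤΔ/rad` of rank two): a unit of `K` fixing `u, w` is the identity.
* `localTubeSpan_janssen_thm2_5_of_residual` — **Theorem 2.5 follows from its residual form** "a unit of
  `K` fixing a unimodular pair of `Δ` lies in `Γ`"; `localTubeSpan_sp2_mem_of_isotropic` — hence the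
  conclusion of Theorem 2.5, UNCONDITIONALLY, for every skew vanishing lattice whose form vanishes on the
  orthogonal of some unimodular pair of `Δ`.

The general residual (for `N/rad N` unimodular it is "`T_m² ∈ Γ` for all `m ∈ N`"; for non-unimodular
`N` it needs the non-unipotent stabiliser words, e.g. `T_{e-f}` for a `3`-plane and hyperbolic level-`4`
elements for a `4`-plane, found by `work/compute/schreier_fixP.py`, `d4_stab.py`) is the line's remaining
arithmetic input.  No named facts; no `sorry`.
-/

-- `Summit.HodgeConjecture.HodgeConjecture.Theorems` is the mandated namespace (single-conjunct summit:
-- Sub = Summit), which `linter.dupNamespace` flags on every declaration; the lakefile turns the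
-- linter off tree-wide (weak option), restated here so stand-alone elaboration is warning-free too.
set_option linter.dupNamespace false

noncomputable section

open Literature.AlgebraicGeometry.HodgeTheory

namespace Summit.HodgeConjecture.HodgeConjecture.Theorems

variable {V : Type} [AddCommGroup V] [Module ℚ V]

/-- **DESCENT TO THE STABILISER OF A UNIMODULAR PAIR.**  For a skew vanishing lattice
with unimodular pair `u, w ∈ Δ` and any unit `g` satisfying the four `Sp♯₂` conditions, there is `h`
in `Γ_Δ`, itself satisfying the four conditions, with `h⁻¹ g` fixing `u` and `w`.  (`g u` is unimodular
and `≡ u (mod 2ℤΔ)`, so reachable from `u` by the moves of C inside `Γ_Δ ⊓ Sp♯₂` (D with the local subgroup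
cut out by K); then `g w = w + 2βu + 2m`, `m ⟂ u, w`, is corrected by `T_u^{∓2β}` and `E_{u,∓m}²`.) [cite: Janssen1983, Thm. 2.5] -/
theorem localTubeSpan_descent [FiniteDimensional ℚ V] (B : LinearMap.BilinForm ℚ V) (hB : B.IsAlt)
    (Δ : Set V) (hΔ : IsSkewVanishingLattice B Δ) {u w : V} (hu : u ∈ Δ) (hw : w ∈ Δ)
    (huw : B u w = 1) (g : (V →ₗ[ℚ] V)ˣ)
    (h1 : ∀ x y : V, B ((g : V →ₗ[ℚ] V) x) ((g : V →ₗ[ℚ] V) y) = B x y)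
    (h2 : ∀ x ∈ Submodule.span ℤ Δ, (g : V →ₗ[ℚ] V) x ∈ Submodule.span ℤ Δ)
    (h3 : ∀ x ∈ Submodule.span ℤ Δ, ((g⁻¹ : (V →ₗ[ℚ] V)ˣ) : V →ₗ[ℚ] V) x ∈ Submodule.span ℤ Δ)
    (h4 : ∀ l : V →ₗ[ℚ] ℚ, (∀ x ∈ Submodule.span ℤ Δ, ∃ z : ℤ, l x = z) →
      ∃ v ∈ Submodule.span ℤ Δ, ∀ x ∈ Submodule.span ℤ Δ, l ((g : V →ₗ[ℚ] V) x - x) = 2 * B v x) :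
    ∃ h ∈ transvectionGroup B Δ,
      (∀ x y : V, B ((h : V →ₗ[ℚ] V) x) ((h : V →ₗ[ℚ] V) y) = B x y) ∧
      (∀ x ∈ Submodule.span ℤ Δ, (h : V →ₗ[ℚ] V) x ∈ Submodule.span ℤ Δ) ∧
      (∀ x ∈ Submodule.span ℤ Δ, ((h⁻¹ : (V →ₗ[ℚ] V)ˣ) : V →ₗ[ℚ] V) x ∈ Submodule.span ℤ Δ) ∧
      (∀ l : V →ₗ[ℚ] ℚ, (∀ x ∈ Submodule.span ℤ Δ, ∃ z : ℤ, l x = z) →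
        ∃ v ∈ Submodule.span ℤ Δ, ∀ x ∈ Submodule.span ℤ Δ, l ((h : V →ₗ[ℚ] V) x - x) = 2 * B v x) ∧
      ((h⁻¹ * g : (V →ₗ[ℚ] V)ˣ) : V →ₗ[ℚ] V) u = u ∧ ((h⁻¹ * g : (V →ₗ[ℚ] V)ˣ) : V →ₗ[ℚ] V) w = w := by
  classical
  have hint := hΔ.integral
  have hwu : B w u = -1 := by rw [← hB.neg_eq, huw]
  have huΛ : u ∈ Submodule.span ℤ Δ := Submodule.subset_span hu
  have hwΛ : w ∈ Submodule.span ℤ Δ := Submodule.subset_span hw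
  -- the `Sp♯₂` conditions as a predicate, and the local subgroup `Γ_Δ ⊓ Sp♯₂`
  let C : (V →ₗ[ℚ] V)ˣ → Prop := fun g =>
    (∀ x y : V, B ((g : V →ₗ[ℚ] V) x) ((g : V →ₗ[ℚ] V) y) = B x y) ∧
    (∀ x ∈ Submodule.span ℤ Δ, (g : V →ₗ[ℚ] V) x ∈ Submodule.span ℤ Δ) ∧
    (∀ x ∈ Submodule.span ℤ Δ, ((g⁻¹ : (V →ₗ[ℚ] V)ˣ) : V →ₗ[ℚ] V) x ∈ Submodule.span ℤ Δ) ∧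
    (∀ l : V →ₗ[ℚ] ℚ, (∀ x ∈ Submodule.span ℤ Δ, ∃ z : ℤ, l x = z) →
      ∃ v ∈ Submodule.span ℤ Δ, ∀ x ∈ Submodule.span ℤ Δ,
        l ((g : V →ₗ[ℚ] V) x - x) = 2 * B v x)
  have hCmul : ∀ g h, C g → C h → C (g * h) := fun g h hg hh =>
    localTubeSpan_sp2Cond_mul B Δ g h hg.1 hg.2.1 hg.2.2.1 hg.2.2.2 hh.1 hh.2.1 hh.2.2.1 hh.2.2.2
  have hCinv : ∀ g, C g → C g⁻¹ := fun g hg =>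
    localTubeSpan_sp2Cond_inv B Δ g hg.1 hg.2.1 hg.2.2.1 hg.2.2.2
  have hCone : C 1 := localTubeSpan_sp2Cond_one B Δ
  have hCsq : ∀ a ∈ Submodule.span ℤ Δ, ∀ g : (V →ₗ[ℚ] V)ˣ,
      (∀ v, (g : V →ₗ[ℚ] V) v = v - (2 : ℚ) • (B v a • a)) → C g := fun a ha g hg =>
    localTubeSpan_sp2Cond_of_sqMove B Δ hB hint ha g hg
  have hCpair : ∀ e ∈ Submodule.span ℤ Δ, ∀ f ∈ Submodule.span ℤ Δ, B e f = 0 →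
      ∀ g : (V →ₗ[ℚ] V)ˣ, (∀ v, (g : V →ₗ[ℚ] V) v = v + (2 : ℚ) • (B v e • f + B v f • e)) → C g :=
    fun e he f hf hef g hg => localTubeSpan_sp2Cond_of_pairMove B Δ hB hint he hf hef g hg
  let ΓK : Subgroup (V →ₗ[ℚ] V)ˣ :=
    { carrier := {g | g ∈ transvectionGroup B Δ ∧ C g}
      one_mem' := ⟨one_mem _, hCone⟩
      mul_mem' := fun {a b} ha hb => ⟨mul_mem ha.1 hb.1, hCmul a b ha.2 hb.2⟩
      inv_mem' := fun {a} ha => ⟨inv_mem ha.1, hCinv a ha.2⟩ }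
  have hΓK : ∀ {g}, g ∈ ΓK ↔ g ∈ transvectionGroup B Δ ∧ C g := fun {g} => Iff.rfl
  -- `u + w ∈ Δ`, `-u ∈ Δ`
  have huwΔ : u + w ∈ Δ := localTubeSpan_pairMoves_add_mem B hB Δ hΔ hu hw huw
  have hnegu : -u ∈ Δ := by
    have hnegw : -w ∈ Δ := localTubeSpan_neg_mem_of_pair B hB Δ hΔ hu hw huw
    have h' : B (-w) u = 1 := by rw [map_neg, LinearMap.neg_apply, hwu, neg_neg]
    exact localTubeSpan_neg_mem_of_pair B hB Δ hΔ hnegw hu h'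
  have hwnegu : B w (-u) = 1 := by rw [map_neg, hwu, neg_neg]
  -- the moves inside `ΓK`
  have hpairK : ∀ e ∈ ({u, w} : Set V), ∀ f ∈ Submodule.span ℤ Δ, B e f = 0 →
      ∃ g ∈ ΓK, ∀ v : V, ((g : (V →ₗ[ℚ] V)ˣ) : V →ₗ[ℚ] V) v = v + (2 : ℚ) • (B v e • f + B v f • e) := by
    intro e he f hf hef
    simp only [Set.mem_insert_iff, Set.mem_singleton_iff] at he
    rcases he with rfl | rfl
    · obtain ⟨g, hg, hgv⟩ := localTubeSpan_pairMoves B hB Δ hΔ hu hw huw hf hef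
      exact ⟨g, hΓK.2 ⟨hg, hCpair e huΛ f hf hef g hgv⟩, hgv⟩
    · obtain ⟨g, hg, hgv⟩ := localTubeSpan_pairMoves B hB Δ hΔ hw hnegu hwnegu hf hef
      exact ⟨g, hΓK.2 ⟨hg, hCpair e hwΛ f hf hef g hgv⟩, hgv⟩
  have hsqK : ∀ a ∈ ({u, w, u + w} : Set V), ∃ g ∈ ΓK, ∀ v : V,
      ((g : (V →ₗ[ℚ] V)ˣ) : V →ₗ[ℚ] V) v = v - (2 : ℚ) • (B v a • a) := by
    intro a ha
    simp only [Set.mem_insert_iff, Set.mem_singleton_iff] at ha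
    have haΔ : a ∈ Δ := by rcases ha with rfl | rfl | rfl <;> assumption
    obtain ⟨g, hg, hgv⟩ := localTubeSpan_sqMove_of_mem B hB Δ haΔ
    exact ⟨g, hΓK.2 ⟨hg, hCsq a (Submodule.subset_span haΔ) g hgv⟩, hgv⟩
  -- Step 1: move `g u` back to `u`
  have hguΛ : (g : V →ₗ[ℚ] V) u ∈ Submodule.span ℤ Δ := h2 u huΛ
  obtain ⟨z₁, hz₁, hz₁e⟩ := localTubeSpan_exists_half_of_even Δ hΔ.fg hΔ.span_eq_top (localTubeSpan_even_of_sp2 B Δ hint g h4 huΛ)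
  have ht : ∃ z ∈ Submodule.span ℤ Δ, (g : V →ₗ[ℚ] V) u = u + (2 : ℚ) • z :=
    ⟨z₁, hz₁, by rw [← hz₁e, add_sub_cancel]⟩
  have htu : ∃ y' ∈ Submodule.span ℤ Δ, B ((g : V →ₗ[ℚ] V) u) y' = 1 :=
    ⟨(g : V →ₗ[ℚ] V) w, h2 w hwΛ, by rw [h1, huw]⟩
  obtain ⟨k₁, hk₁, hk₁u⟩ := localTubeSpan_unimodularTransitivity_local B hB Δ hint ΓK huΛ hwΛ huw hpairK hsqK
    ht htu
  obtain ⟨hk₁Γ, hk₁C⟩ := hΓK.1 hk₁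
  -- `g₁ = k₁⁻¹ g` fixes `u`
  set g₁ : (V →ₗ[ℚ] V)ˣ := k₁⁻¹ * g with hg₁def
  have hg₁C : C g₁ := hCmul _ _ (hCinv _ hk₁C) ⟨h1, h2, h3, h4⟩
  have hg₁u : (g₁ : V →ₗ[ℚ] V) u = u := by
    rw [hg₁def, Units.val_mul, Module.End.mul_apply, ← hk₁u, localTubeSpan_units_inv_apply_apply]
  obtain ⟨hg₁1, hg₁2, hg₁3, hg₁4⟩ := hg₁C
  -- Step 2: `g₁ w = w + 2 z₂` with `z₂ ⟂ u`; correct it by `E_{u,-z₂}²` and `T_u^{2k}`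
  have hg₁wΛ : (g₁ : V →ₗ[ℚ] V) w ∈ Submodule.span ℤ Δ := hg₁2 w hwΛ
  obtain ⟨z₂, hz₂, hz₂e⟩ := localTubeSpan_exists_half_of_even Δ hΔ.fg hΔ.span_eq_top (localTubeSpan_even_of_sp2 B Δ hint g₁ hg₁4 hwΛ)
  have hus : B u ((g₁ : V →ₗ[ℚ] V) w) = 1 := by
    conv_lhs => rw [← hg₁u]
    rw [hg₁1, huw]
  have huz₂ : B u z₂ = 0 := by
    have h0 : B u ((g₁ : V →ₗ[ℚ] V) w - w) = 0 := by rw [map_sub, hus, huw, sub_self]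
    rw [hz₂e, map_smul, smul_eq_mul] at h0
    linarith
  have hnz₂ : -z₂ ∈ Submodule.span ℤ Δ := Submodule.neg_mem _ hz₂
  have hunz₂ : B u (-z₂) = 0 := by rw [map_neg, huz₂, neg_zero]
  obtain ⟨p, hp, hpv⟩ := localTubeSpan_pairMoves B hB Δ hΔ hu hw huw hnz₂ hunz₂
  have hpC : C p := hCpair u huΛ (-z₂) hnz₂ hunz₂ p hpv
  obtain ⟨q, hq, hqv⟩ := localTubeSpan_sqMove_of_mem B hB Δ hu
  have hqC : C q := hCsq u huΛ q hqv
  obtain ⟨k, hk⟩ := localTubeSpan_integral_span B Δ hint hwΛ hz₂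
  -- `h₂ := q^k * p` maps `w ↦ g₁ w` and fixes `u`
  set h₂ : (V →ₗ[ℚ] V)ˣ := q ^ k * p with hh₂def
  have hh₂Γ : h₂ ∈ transvectionGroup B Δ := mul_mem (Subgroup.zpow_mem _ hq k) hp
  have hqkK : q ^ k ∈ ΓK := Subgroup.zpow_mem _ (hΓK.2 ⟨hq, hqC⟩) k
  have hh₂C : C h₂ := hCmul _ _ (hΓK.1 hqkK).2 hpC
  have hpu : ((p : (V →ₗ[ℚ] V)ˣ) : V →ₗ[ℚ] V) u = u := by
    rw [hpv, hB.self_eq_zero u, hunz₂, zero_smul, zero_smul, add_zero, smul_zero, add_zero]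
  have hpw : ((p : (V →ₗ[ℚ] V)ˣ) : V →ₗ[ℚ] V) w = (g₁ : V →ₗ[ℚ] V) w - (2 * (k : ℚ)) • u := by
    have hwz : B w (-z₂) = -k := by rw [map_neg, hk]
    have e1 : (g₁ : V →ₗ[ℚ] V) w = w + (2 : ℚ) • z₂ := by rw [← hz₂e]; abel
    rw [hpv, hwu, hwz, e1]
    module
  have hh₂u : ((h₂ : (V →ₗ[ℚ] V)ˣ) : V →ₗ[ℚ] V) u = u := by
    rw [hh₂def, Units.val_mul, Module.End.mul_apply, hpu, localTubeSpan_sqMove_zpow_apply B hB u q hqv k u,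
      hB.self_eq_zero u, zero_smul, smul_zero, sub_zero]
  have hh₂w : ((h₂ : (V →ₗ[ℚ] V)ˣ) : V →ₗ[ℚ] V) w = (g₁ : V →ₗ[ℚ] V) w := by
    rw [hh₂def, Units.val_mul, Module.End.mul_apply, hpw, localTubeSpan_sqMove_zpow_apply B hB u q hqv k,
      map_sub, map_smul, LinearMap.sub_apply, LinearMap.smul_apply, hB.self_eq_zero u, ← hB.neg_eq u,
      hus]
    module
  -- the descent element `h := k₁ * h₂`
  refine ⟨k₁ * h₂, mul_mem hk₁Γ hh₂Γ, ?_⟩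
  have hkC : C (k₁ * h₂) := hCmul _ _ hk₁C hh₂C
  refine ⟨hkC.1, hkC.2.1, hkC.2.2.1, hkC.2.2.2, ?_, ?_⟩
  · rw [mul_inv_rev, mul_assoc, ← hg₁def, Units.val_mul, Module.End.mul_apply, hg₁u, ← hh₂u,
      localTubeSpan_units_inv_apply_apply, hh₂u]
  · rw [mul_inv_rev, mul_assoc, ← hg₁def, Units.val_mul, Module.End.mul_apply, ← hh₂w,
      localTubeSpan_units_inv_apply_apply]


/-- THE RESIDUAL IN THE TOTALLY DEGENERATE CASE.  If the form vanishes on the orthogonal `N` of the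
unimodular pair `(u, w)` inside `ℤΔ` (i.e. `ℤΔ / rad` has rank two), a unit satisfying the four `Sp♯₂`
conditions and fixing `u, w` is the identity: for `m ∈ N`, `l(g m - m) = 2⟨v, m⟩ = 2⟨v_N, m⟩ = 0` for
every integral `l`. [cite: Janssen1983, Thm. 2.5] -/
theorem localTubeSpan_residual_of_isotropic [FiniteDimensional ℚ V] (B : LinearMap.BilinForm ℚ V)
    (hB : B.IsAlt) (Δ : Set V) (hΔ : IsSkewVanishingLattice B Δ) {u w : V} (hu : u ∈ Δ) (hw : w ∈ Δ)
    (huw : B u w = 1)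
    (hN : ∀ m ∈ Submodule.span ℤ Δ, ∀ m' ∈ Submodule.span ℤ Δ,
      B u m = 0 → B w m = 0 → B u m' = 0 → B w m' = 0 → B m m' = 0)
    (g : (V →ₗ[ℚ] V)ˣ)
    (h4 : ∀ l : V →ₗ[ℚ] ℚ, (∀ x ∈ Submodule.span ℤ Δ, ∃ z : ℤ, l x = z) →
      ∃ v ∈ Submodule.span ℤ Δ, ∀ x ∈ Submodule.span ℤ Δ, l ((g : V →ₗ[ℚ] V) x - x) = 2 * B v x)
    (hgu : (g : V →ₗ[ℚ] V) u = u) (hgw : (g : V →ₗ[ℚ] V) w = w) : g = 1 := by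
  have hwu : B w u = -1 := by rw [← hB.neg_eq, huw]
  have huΛ : ∀ {x}, x ∈ Δ → x ∈ Submodule.span ℤ Δ := fun hx => Submodule.subset_span hx
  -- the `N`-projection `π x = x - ⟨x,w⟩u + ⟨x,u⟩w`
  have hint := hΔ.integral
  -- every lattice vector orthogonal to `u, w` is fixed
  have hfixN : ∀ m ∈ Submodule.span ℤ Δ, B u m = 0 → B w m = 0 → (g : V →ₗ[ℚ] V) m = m := by
    intro m hm hum hwm
    have h0 : (g : V →ₗ[ℚ] V) m - m = 0 := by
      refine localTubeSpan_eq_zero_of_integral_functionals Δ hΔ.fg hΔ.span_eq_top fun l hl => ?_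
      obtain ⟨v, hv, hvx⟩ := h4 l hl
      -- split `v` into its plane part and its `N` part
      have hvN : B v m = B (v - B v w • u + B v u • w) m := by
        rw [map_add, map_sub, map_smul, map_smul, LinearMap.add_apply, LinearMap.sub_apply,
          LinearMap.smul_apply, LinearMap.smul_apply, hum, hwm, smul_eq_mul, smul_eq_mul, mul_zero,
          mul_zero, sub_zero, add_zero]
      have hπmem : v - B v w • u + B v u • w ∈ Submodule.span ℤ Δ := by
        obtain ⟨a, ha⟩ := localTubeSpan_integral_span B Δ hint hv (huΛ hw)
        obtain ⟨b, hb⟩ := localTubeSpan_integral_span B Δ hint hv (huΛ hu)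
        rw [ha, hb]
        exact Submodule.add_mem _ (Submodule.sub_mem _ hv (localTubeSpan_intCast_smul_mem Δ (huΛ hu) a))
          (localTubeSpan_intCast_smul_mem Δ (huΛ hw) b)
      have hπu : B u (v - B v w • u + B v u • w) = 0 := by
        rw [map_add, map_sub, map_smul, map_smul, hB.self_eq_zero u, huw, smul_eq_mul, smul_eq_mul,
          mul_zero, sub_zero, mul_one, ← hB.neg_eq v u]
        ring
      have hπw : B w (v - B v w • u + B v u • w) = 0 := by
        rw [map_add, map_sub, map_smul, map_smul, hB.self_eq_zero w, hwu, smul_eq_mul, smul_eq_mul,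
          mul_zero, add_zero, ← hB.neg_eq v w]
        ring
      rw [hvx m hm, hvN, hN _ hπmem m hm hπu hπw hum hwm, mul_zero]
    exact sub_eq_zero.1 h0
  -- hence every lattice vector is fixed: `x = π x + ⟨x,w⟩u - ⟨x,u⟩w`
  have hfixΛ : ∀ x ∈ Submodule.span ℤ Δ, (g : V →ₗ[ℚ] V) x = x := by
    intro x hx
    obtain ⟨a, ha⟩ := localTubeSpan_integral_span B Δ hint hx (huΛ hw)
    obtain ⟨b, hb⟩ := localTubeSpan_integral_span B Δ hint hx (huΛ hu)
    have hπmem : x - B x w • u + B x u • w ∈ Submodule.span ℤ Δ := by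
      rw [ha, hb]
      exact Submodule.add_mem _ (Submodule.sub_mem _ hx (localTubeSpan_intCast_smul_mem Δ (huΛ hu) a))
        (localTubeSpan_intCast_smul_mem Δ (huΛ hw) b)
    have hπu : B u (x - B x w • u + B x u • w) = 0 := by
      rw [map_add, map_sub, map_smul, map_smul, hB.self_eq_zero u, huw, smul_eq_mul, smul_eq_mul,
        mul_zero, sub_zero, mul_one, ← hB.neg_eq x u]
      ring
    have hπw : B w (x - B x w • u + B x u • w) = 0 := by
      rw [map_add, map_sub, map_smul, map_smul, hB.self_eq_zero w, hwu, smul_eq_mul, smul_eq_mul,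
        mul_zero, add_zero, ← hB.neg_eq x w]
      ring
    have h := hfixN _ hπmem hπu hπw
    rw [map_add, map_sub, map_smul, map_smul, hgu, hgw] at h
    -- `g x - ⟨x,w⟩u + ⟨x,u⟩w = x - ⟨x,w⟩u + ⟨x,u⟩w`
    have := congrArg (fun y => y + B x w • u - B x u • w) h
    simpa using this
  -- and every vector (`Δ` spans `V`)
  have hfix : ∀ x : V, (g : V →ₗ[ℚ] V) x = x := by
    intro x
    have hx : x ∈ Submodule.span ℚ Δ := by rw [hΔ.span_eq_top]; trivial
    induction hx using Submodule.span_induction with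
    | mem y hy => exact hfixΛ y (huΛ hy)
    | zero => rw [map_zero]
    | add y z _ _ hy hz => rw [map_add, hy, hz]
    | smul c y _ hy => rw [map_smul, hy]
  exact Units.ext (LinearMap.ext fun x => by rw [hfix x, Units.val_one, Module.End.one_apply])


/-- **Janssen's Theorem 2.5 from its residual** (descent at the pair `(δ₁, δ₂)` of the definition, then
the residual for the stabiliser element, which again satisfies the four conditions by `…Sp2Closure`).
[cite: Janssen1983, Thm. 2.5] -/
theorem localTubeSpan_janssen_thm2_5_of_residual
    (hres : ∀ (W : Type) [AddCommGroup W] [Module ℚ W] [FiniteDimensional ℚ W]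
      (B : LinearMap.BilinForm ℚ W), B.IsAlt → ∀ Δ : Set W, IsSkewVanishingLattice B Δ →
      ∀ ⦃u w : W⦄, u ∈ Δ → w ∈ Δ → B u w = 1 → ∀ g : (W →ₗ[ℚ] W)ˣ,
        (∀ x y : W, B ((g : W →ₗ[ℚ] W) x) ((g : W →ₗ[ℚ] W) y) = B x y) →
        (∀ x ∈ Submodule.span ℤ Δ, (g : W →ₗ[ℚ] W) x ∈ Submodule.span ℤ Δ) →
        (∀ x ∈ Submodule.span ℤ Δ, ((g⁻¹ : (W →ₗ[ℚ] W)ˣ) : W →ₗ[ℚ] W) x ∈ Submodule.span ℤ Δ) →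
        (∀ l : W →ₗ[ℚ] ℚ, (∀ x ∈ Submodule.span ℤ Δ, ∃ z : ℤ, l x = z) →
          ∃ v ∈ Submodule.span ℤ Δ, ∀ x ∈ Submodule.span ℤ Δ,
            l ((g : W →ₗ[ℚ] W) x - x) = 2 * B v x) →
        (g : W →ₗ[ℚ] W) u = u → (g : W →ₗ[ℚ] W) w = w → g ∈ transvectionGroup B Δ) :
    Janssen1983_thm2_5 := by
  intro W _ _ _ B hB Δ hΔ g h1 h2 h3 h4
  obtain ⟨u, hu, w, hw, huw⟩ := hΔ.exists_pair
  obtain ⟨h, hh, hh1, hh2, hh3, hh4, hgu, hgw⟩ :=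
    localTubeSpan_descent B hB Δ hΔ hu hw huw g h1 h2 h3 h4
  obtain ⟨hi1, hi2, hi3, hi4⟩ := localTubeSpan_sp2Cond_inv B Δ h hh1 hh2 hh3 hh4
  obtain ⟨hm1, hm2, hm3, hm4⟩ :=
    localTubeSpan_sp2Cond_mul B Δ h⁻¹ g hi1 hi2 hi3 hi4 h1 h2 h3 h4
  have hmem : h⁻¹ * g ∈ transvectionGroup B Δ :=
    hres W B hB Δ hΔ hu hw huw (h⁻¹ * g) hm1 hm2 hm3 hm4 hgu hgw
  simpa using mul_mem hh hmem

/-- **The conclusion of Janssen's Theorem 2.5, unconditionally, when the form vanishes on the orthogonal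
of a unimodular pair of `Δ`** (`ℤΔ / rad` of rank two — e.g. the vanishing lattices of the curve
singularities `A₂`, `A₃`, `D₄`): every unit of `Sp♯₂(ℤΔ)` is monodromy.  (Descent, then the isotropic
residual: the stabiliser element is the identity.) [cite: Janssen1983, Thm. 2.5] -/
theorem localTubeSpan_sp2_mem_of_isotropic [FiniteDimensional ℚ V] (B : LinearMap.BilinForm ℚ V)
    (hB : B.IsAlt) (Δ : Set V) (hΔ : IsSkewVanishingLattice B Δ) {u w : V} (hu : u ∈ Δ) (hw : w ∈ Δ)
    (huw : B u w = 1)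
    (hN : ∀ m ∈ Submodule.span ℤ Δ, ∀ m' ∈ Submodule.span ℤ Δ,
      B u m = 0 → B w m = 0 → B u m' = 0 → B w m' = 0 → B m m' = 0)
    (g : (V →ₗ[ℚ] V)ˣ)
    (h1 : ∀ x y : V, B ((g : V →ₗ[ℚ] V) x) ((g : V →ₗ[ℚ] V) y) = B x y)
    (h2 : ∀ x ∈ Submodule.span ℤ Δ, (g : V →ₗ[ℚ] V) x ∈ Submodule.span ℤ Δ)
    (h3 : ∀ x ∈ Submodule.span ℤ Δ, ((g⁻¹ : (V →ₗ[ℚ] V)ˣ) : V →ₗ[ℚ] V) x ∈ Submodule.span ℤ Δ)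
    (h4 : ∀ l : V →ₗ[ℚ] ℚ, (∀ x ∈ Submodule.span ℤ Δ, ∃ z : ℤ, l x = z) →
      ∃ v ∈ Submodule.span ℤ Δ, ∀ x ∈ Submodule.span ℤ Δ, l ((g : V →ₗ[ℚ] V) x - x) = 2 * B v x) :
    g ∈ transvectionGroup B Δ := by
  obtain ⟨h, hh, hh1, hh2, hh3, hh4, hgu, hgw⟩ :=
    localTubeSpan_descent B hB Δ hΔ hu hw huw g h1 h2 h3 h4
  obtain ⟨hi1, hi2, hi3, hi4⟩ := localTubeSpan_sp2Cond_inv B Δ h hh1 hh2 hh3 hh4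
  obtain ⟨-, -, -, hm4⟩ :=
    localTubeSpan_sp2Cond_mul B Δ h⁻¹ g hi1 hi2 hi3 hi4 h1 h2 h3 h4
  have hone : h⁻¹ * g = 1 :=
    localTubeSpan_residual_of_isotropic B hB Δ hΔ hu hw huw hN (h⁻¹ * g) hm4 hgu hgw
  have : g = h := by
    have := congrArg (fun t => h * t) hone
    simpa using this
  rw [this]
  exact hh

end Summit.HodgeConjecture.HodgeConjecture.Theorems

end
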